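import Literature.AnabelianGeometry.EtaleTheta.Discharge.Sec1ZNSplittingOfCuspSection
import HarnessLib

/-!
# [EtTh] §1 p. 14: `γ(Π^tp_{Z_N,α}) = Π^tp_{Z_N,β}` for the CONTINUOUS-splitting reading of the construction
# of `Z_N` — continuity of the transported splitting, given that `Π^tp_X ↠ G_K` is an open map

Mochizuki, *The étale theta function and its Frobenioid-theoretic manifestations*, Publ. RIMS **45**
(2009), §1, PRIMS PDF p. 14: "Since any two splittings of this exact sequence differ by a cohomology class
`∈ H¹(G_{K_N}, ℤ/Nℤ(1))`, it follows [by the definition of `J_N`] that all splittings of this exact sequence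
determine the same splitting over `G_{J_N}`" [cite: MochizukiEtTh2009, §1 p.14] — splittings of an exact
sequence of profinite groups being CONTINUOUS (the reading recorded by FINDING F-L2d1g5-1; L2-lead R405:
"consumers quantify over continuous splittings by an explicit hypothesis").

abc-iut cell, layer L2, seat abc-iut-L2-t1 (§1 ROOT owner, gen 6). PROOF-ONLY companion (no definition,
no `Prop`-valued definition, no new named fact) of `Sec1ZNTransportOfSplitting.lean` (p454350:
`exists_transport_splitting` — the transported splitting `s_β` with its value relation
`s_β(aug_β(γ x)) = γ^Θ(s_α(aug_α x))`) and `Sec1ZNSplittingOfCuspSection.lean` (p456637), this seat.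
The continuous reading of the clause is written INLINE as a hypothesis
(`∀ s, Continuous s → IsThetaSplittingAt D N s → …`), no predicate being introduced.

* **`Thm16Sub.continuous_of_transport_rel`** — if `s_α` is continuous and **`Π^tp_{Xβ} ↠ G_{ℚ_p}` is an
  open map** (`IsOpenMap Dβ.aug`, a plain Mathlib predicate on the interface datum: the one topological
  input the transport of continuity needs, true of the genuine tempered fundamental group), then every
  `s_β` satisfying the value relation is continuous: `x ↦ aug_β(γ x)` restricted to
  `{x | aug_α x ∈ G_{K_N,α}}` is an open continuous surjection onto `G_{K_N,β}`, hence a quotient map, and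
  `s_β` composed with it is `γ^Θ ∘ s_α ∘ aug_α`;
* `Thm16Sub.map_GtpZN_eq_of_clause_pair` — `γ(Π^tp_{Z_N,α}) = Π^tp_{Z_N,β}` from the printed
  characterisation of `Π^tp_{Z_N}` for ONE pair of related lifted splittings `(s_α, s_β)` (the membership
  chase of p454350, for a given pair);
* **`Thm16Sub.map_GtpZN_eq_of_contSplitting`** — hZN at level `N` with the `β`-side clause quantified
  over CONTINUOUS lifted splittings only, the `α` side in ∃-form with a continuous splitting; inputs as in
  `map_GtpZN_eq_of_exists_splitting` plus `IsOpenMap Dβ.aug`;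
* `Thm16Sub.continuous_thetaSplitting_of_cuspSection`, **`map_GtpZN_eq_of_contSplitting_of_cuspSection`**
  — with the `α`-side continuous splitting supplied by a CONTINUOUS cusp section (`σ ↦ (s σ)^Θ`,
  p456637) and the continuous clause on both sides.

HONEST FRAMING: [EtTh] is refereed; nothing asserted; the continuous clause and `IsOpenMap aug` are
explicit hypotheses; typed ≠ proved; nothing here bears on [IUTchIII] Cor. 3.12.
-/

noncomputable section

namespace Literature.AnabelianGeometry.EtaleTheta

open Literature.AnabelianGeometry.SemiGraphs

namespace Thm16Sub

variable {p : ℕ} [Fact p.Prime]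

/-- The lifted splitting `σ ↦ (s σ)^Θ` of a CONTINUOUS cusp section is continuous.
[cite: MochizukiEtTh2009, §1 p.14] -/
theorem continuous_thetaSplitting_of_cuspSection (D : ThetaSetting p) (N : ℕ+) (s : GQp p →* D.PiTemp)
    (hs : Continuous s) : Continuous (fun σ : ↥(D.GKN N) => D.toTheta (s (σ : GQp p))) :=
  D.continuous_toTheta.comp (hs.comp continuous_subtype_val)

section TwoSettings

variable (Dα Dβ : ThetaSetting p) (γ : Dα.PiTemp ≃ₜ* Dβ.PiTemp)
  (hΔ : Dα.DeltaTemp.map γ.toMulEquiv.toMonoidHom = Dβ.DeltaTemp)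

/-- **Continuity of the transported splitting.** If `Π^tp_{Xβ} ↠ G_{ℚ_p}` is an open map, `s_α` is
continuous and `s_β(aug_β(γ x)) = γ^Θ(s_α(aug_α x))` whenever `aug_α x ∈ G_{K_N,α}`, then `s_β` is continuous:
`x ↦ aug_β(γ x)` on `{x | aug_α x ∈ G_{K_N,α}}` is an open continuous surjection onto `G_{K_N,β}`, hence a
quotient map. [cite: MochizukiEtTh2009, §1 p.14] -/
theorem continuous_of_transport_rel (N : ℕ+) (c : ThetaSetting.ThetaCompanion γ)
    (haugN : ∀ g : Dα.PiTemp, Dβ.aug (γ.toMulEquiv g) ∈ Dβ.GKN N ↔ Dα.aug g ∈ Dα.GKN N)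
    (hopen : IsOpenMap Dβ.aug)
    {sα : ↥(Dα.GKN N) → Dα.GtpTheta} (hsαc : Continuous sα) {sβ : ↥(Dβ.GKN N) → Dβ.GtpTheta}
    (hrel : ∀ (x : Dα.PiTemp) (hxα : Dα.aug x ∈ Dα.GKN N) (hxβ : Dβ.aug (γ.toMulEquiv x) ∈ Dβ.GKN N),
      sβ ⟨Dβ.aug (γ.toMulEquiv x), hxβ⟩ = c.thetaIso.toMulEquiv (sα ⟨Dα.aug x, hxα⟩)) :
    Continuous sβ := by
  -- the open set of `Π^tp_{Xα}` over `G_{K_N,α}`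
  have hV : IsOpen ((Dα.aug : Dα.PiTemp → GQp p) ⁻¹' (Dα.GKN N : Set (GQp p))) :=
    (Dα.isOpen_GKN N).preimage Dα.aug.continuous
  -- `q : V → G_{K_N,β}`, `x ↦ aug_β (γ x)`
  let q : ↥((Dα.aug : Dα.PiTemp → GQp p) ⁻¹' (Dα.GKN N : Set (GQp p))) → ↥(Dβ.GKN N) :=
    fun x => ⟨Dβ.aug (γ.toMulEquiv x.1), (haugN x.1).2 x.2⟩
  have hf : Continuous fun x : Dα.PiTemp => Dβ.aug (γ.toMulEquiv x) :=
    Dβ.aug.continuous.comp (map_continuous γ)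
  have hqc : Continuous q := Continuous.subtype_mk (hf.comp continuous_subtype_val) _
  have hqs : Function.Surjective q := by
    intro σ'
    obtain ⟨g', -, hg'⟩ := exists_mem_GtpYN_aug_eq Dβ N σ'.2
    have hx : Dα.aug (γ.toMulEquiv.symm g') ∈ Dα.GKN N := by
      rw [← haugN, MulEquiv.apply_symm_apply, hg']
      exact σ'.2
    refine ⟨⟨γ.toMulEquiv.symm g', hx⟩, Subtype.ext ?_⟩
    change Dβ.aug (γ.toMulEquiv (γ.toMulEquiv.symm g')) = σ'
    rw [MulEquiv.apply_symm_apply, hg']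
  have hfo : IsOpenMap fun x : Dα.PiTemp => Dβ.aug (γ.toMulEquiv x) := by
    intro U hU
    have h1 : IsOpen ((γ.toMulEquiv : Dα.PiTemp → Dβ.PiTemp) '' U) := by
      have h := (γ : Dα.PiTemp ≃ₜ Dβ.PiTemp).isOpenMap U hU
      exact h
    have h2 := hopen _ h1
    rwa [← Set.image_comp] at h2
  have hqo : IsOpenMap q := by
    intro W hW
    have hset : q '' W = Subtype.val ⁻¹'
        ((fun x : Dα.PiTemp => Dβ.aug (γ.toMulEquiv x)) '' (Subtype.val '' W)) := by
      ext σ'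
      constructor
      · rintro ⟨w, hw, rfl⟩
        exact ⟨w.1, ⟨w, hw, rfl⟩, rfl⟩
      · rintro ⟨x, ⟨w, hw, rfl⟩, hxσ⟩
        exact ⟨w, hw, Subtype.ext hxσ⟩
    rw [hset]
    exact (hfo _ (hV.isOpenMap_subtype_val W hW)).preimage continuous_subtype_val
  have hquot : Topology.IsQuotientMap q := hqo.isQuotientMap hqc hqs
  rw [hquot.continuous_iff]
  have heq : sβ ∘ q = fun x => c.thetaIso.toMulEquiv (sα ⟨Dα.aug x.1, x.2⟩) := by
    funext x
    exact hrel x.1 x.2 _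
  rw [heq]
  exact (map_continuous c.thetaIso).comp
    (hsαc.comp (Continuous.subtype_mk (Dα.aug.continuous.comp continuous_subtype_val) _))

include hΔ in
/-- `γ(Π^tp_{Z_N,α}) = Π^tp_{Z_N,β}` from the printed characterisation of `Π^tp_{Z_N}` on both sides for ONE
pair of lifted splittings related by `s_β(aug_β(γ x)) = γ^Θ(s_α(aug_α x))` (the membership chase of
`map_GtpZN_eq_of_exists_splitting`, p454350, for a given pair). [cite: MochizukiEtTh2009, §1 p.14] -/
theorem map_GtpZN_eq_of_clause_pair (N : ℕ+) (c : ThetaSetting.ThetaCompanion γ)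
    (hY : Dα.GtpY.map γ.toMulEquiv.toMonoidHom = Dβ.GtpY)
    (hYN : (Dα.GtpYN N).map γ.toMulEquiv.toMonoidHom = Dβ.GtpYN N)
    (haugJN : ∀ g : Dα.PiTemp, Dβ.aug (γ.toMulEquiv g) ∈ Dβ.GJN N ↔ Dα.aug g ∈ Dα.GJN N)
    {sα : ↥(Dα.GKN N) → Dα.GtpTheta} {sβ : ↥(Dβ.GKN N) → Dβ.GtpTheta}
    (hrel : ∀ (x : Dα.PiTemp) (hxα : Dα.aug x ∈ Dα.GKN N) (hxβ : Dβ.aug (γ.toMulEquiv x) ∈ Dβ.GKN N),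
      sβ ⟨Dβ.aug (γ.toMulEquiv x), hxβ⟩ = c.thetaIso.toMulEquiv (sα ⟨Dα.aug x, hxα⟩))
    (hZα : ∀ g : Dα.PiTemp, g ∈ Dα.GtpZN N ↔ g ∈ Dα.GtpYN N ∧ ∃ h : Dα.aug g ∈ Dα.GJN N,
      Dα.toTheta g * (sα ⟨Dα.aug g, Dα.GJN_le_GKN N h⟩)⁻¹ ∈ Dα.thetaPowersY N)
    (hZβ : ∀ g : Dβ.PiTemp, g ∈ Dβ.GtpZN N ↔ g ∈ Dβ.GtpYN N ∧ ∃ h : Dβ.aug g ∈ Dβ.GJN N,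
      Dβ.toTheta g * (sβ ⟨Dβ.aug g, Dβ.GJN_le_GKN N h⟩)⁻¹ ∈ Dβ.thetaPowersY N) :
    (Dα.GtpZN N).map γ.toMulEquiv.toMonoidHom = Dβ.GtpZN N := by
  have hYx : ∀ x : Dα.PiTemp, γ.toMulEquiv x ∈ Dβ.GtpYN N ↔ x ∈ Dα.GtpYN N := fun x => by
    rw [← hYN]
    exact mem_map_iff_of_equiv Dα Dβ γ _ x
  ext y
  obtain ⟨x, rfl⟩ := γ.toMulEquiv.surjective y
  rw [mem_map_iff_of_equiv, hZα x, hZβ (γ.toMulEquiv x)]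
  constructor
  · rintro ⟨hxY, hxJ, hmem⟩
    have hxJβ : Dβ.aug (γ.toMulEquiv x) ∈ Dβ.GJN N := (haugJN x).2 hxJ
    refine ⟨(hYx x).2 hxY, hxJβ, ?_⟩
    rw [hrel x (Dα.GJN_le_GKN N hxJ) (Dβ.GJN_le_GKN N hxJβ), c.comm, ← map_inv, ← map_mul,
      ← map_thetaPowersY_eq Dα Dβ γ hΔ c hY N]
    exact ⟨_, hmem, rfl⟩
  · rintro ⟨hxY, hxJβ, hmem⟩
    have hxJ : Dα.aug x ∈ Dα.GJN N := (haugJN x).1 hxJβ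
    refine ⟨(hYx x).1 hxY, hxJ, ?_⟩
    rw [hrel x (Dα.GJN_le_GKN N hxJ) (Dβ.GJN_le_GKN N hxJβ), c.comm, ← map_inv, ← map_mul,
      ← map_thetaPowersY_eq Dα Dβ γ hΔ c hY N] at hmem
    obtain ⟨z, hz, hze⟩ := hmem
    rwa [← c.thetaIso.toMulEquiv.injective hze]

include hΔ in
/-- **`γ(Π^tp_{Z_N,α}) = Π^tp_{Z_N,β}` for the CONTINUOUS reading of the construction of `Z_N`** (p. 14):
as `map_GtpZN_eq_of_exists_splitting`, with the `β`-side characterisation quantified over CONTINUOUS lifted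
splittings only and a continuous splitting in the `α`-side ∃-form, granted that `Π^tp_{Xβ} ↠ G_{ℚ_p}` is
an open map. [cite: MochizukiEtTh2009, §1 p.14] -/
theorem map_GtpZN_eq_of_contSplitting (N : ℕ+) (c : ThetaSetting.ThetaCompanion γ)
    (hY : Dα.GtpY.map γ.toMulEquiv.toMonoidHom = Dβ.GtpY)
    (hYN : (Dα.GtpYN N).map γ.toMulEquiv.toMonoidHom = Dβ.GtpYN N)
    (haugN : ∀ g : Dα.PiTemp, Dβ.aug (γ.toMulEquiv g) ∈ Dβ.GKN N ↔ Dα.aug g ∈ Dα.GKN N)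
    (haugJN : ∀ g : Dα.PiTemp, Dβ.aug (γ.toMulEquiv g) ∈ Dβ.GJN N ↔ Dα.aug g ∈ Dα.GJN N)
    (hopen : IsOpenMap Dβ.aug)
    (hzα : ∃ sα : ↥(Dα.GKN N) → Dα.GtpTheta, Continuous sα ∧ Dα.IsThetaSplittingAt N sα ∧
      ∀ g : Dα.PiTemp, g ∈ Dα.GtpZN N ↔
        g ∈ Dα.GtpYN N ∧ ∃ h : Dα.aug g ∈ Dα.GJN N,
          Dα.toTheta g * (sα ⟨Dα.aug g, Dα.GJN_le_GKN N h⟩)⁻¹ ∈ Dα.thetaPowersY N)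
    (hzβ : ∀ s : ↥(Dβ.GKN N) → Dβ.GtpTheta, Continuous s → Dβ.IsThetaSplittingAt N s →
      ∀ g : Dβ.PiTemp, g ∈ Dβ.GtpZN N ↔
        g ∈ Dβ.GtpYN N ∧ ∃ h : Dβ.aug g ∈ Dβ.GJN N,
          Dβ.toTheta g * (s ⟨Dβ.aug g, Dβ.GJN_le_GKN N h⟩)⁻¹ ∈ Dβ.thetaPowersY N) :
    (Dα.GtpZN N).map γ.toMulEquiv.toMonoidHom = Dβ.GtpZN N := by
  obtain ⟨sα, hsαc, hsα, hZα⟩ := hzα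
  obtain ⟨sβ, hsβ, hrel⟩ := exists_transport_splitting Dα Dβ γ hΔ N c hY hYN haugN hsα
  exact map_GtpZN_eq_of_clause_pair Dα Dβ γ hΔ N c hY hYN haugJN hrel hZα
    (hzβ sβ (continuous_of_transport_rel Dα Dβ γ N c haugN hopen hsαc hrel) hsβ)

include hΔ in
/-- **The same with the `α`-side continuous splitting from a continuous CUSP SECTION** `s : G_{Kα} → D_c`
(`σ ↦ (s σ)^Θ`, p456637) and the continuous characterisation on both sides. [cite: MochizukiEtTh2009, §1 p.14] -/
theorem map_GtpZN_eq_of_contSplitting_of_cuspSection (N : ℕ+) (c : ThetaSetting.ThetaCompanion γ)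
    (hY : Dα.GtpY.map γ.toMulEquiv.toMonoidHom = Dβ.GtpY)
    (hYN : (Dα.GtpYN N).map γ.toMulEquiv.toMonoidHom = Dβ.GtpYN N)
    (haugN : ∀ g : Dα.PiTemp, Dβ.aug (γ.toMulEquiv g) ∈ Dβ.GKN N ↔ Dα.aug g ∈ Dα.GKN N)
    (haugJN : ∀ g : Dα.PiTemp, Dβ.aug (γ.toMulEquiv g) ∈ Dβ.GJN N ↔ Dα.aug g ∈ Dα.GJN N)
    (hopen : IsOpenMap Dβ.aug) (hcusp : GtpYNFromCusp Dα N)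
    {Dc : Subgroup Dα.PiTemp} (hDc : Dα.IsCuspidalDecompositionGroup Dc) (hDcY : Dc ≤ Dα.GtpY)
    (s : GQp p →* Dα.PiTemp) (hs : Continuous s) (hsec : ∀ g : GQp p, g ∈ Dα.GK → Dα.aug (s g) = g)
    (hsD : Dα.GK.map s ≤ Dc)
    (hzα : ∀ t : ↥(Dα.GKN N) → Dα.GtpTheta, Continuous t → Dα.IsThetaSplittingAt N t →
      ∀ g : Dα.PiTemp, g ∈ Dα.GtpZN N ↔
        g ∈ Dα.GtpYN N ∧ ∃ h : Dα.aug g ∈ Dα.GJN N,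
          Dα.toTheta g * (t ⟨Dα.aug g, Dα.GJN_le_GKN N h⟩)⁻¹ ∈ Dα.thetaPowersY N)
    (hzβ : ∀ t : ↥(Dβ.GKN N) → Dβ.GtpTheta, Continuous t → Dβ.IsThetaSplittingAt N t →
      ∀ g : Dβ.PiTemp, g ∈ Dβ.GtpZN N ↔
        g ∈ Dβ.GtpYN N ∧ ∃ h : Dβ.aug g ∈ Dβ.GJN N,
          Dβ.toTheta g * (t ⟨Dβ.aug g, Dβ.GJN_le_GKN N h⟩)⁻¹ ∈ Dβ.thetaPowersY N) :
    (Dα.GtpZN N).map γ.toMulEquiv.toMonoidHom = Dβ.GtpZN N :=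
  have hcont := continuous_thetaSplitting_of_cuspSection Dα N s hs
  have hsplit := isThetaSplittingAt_of_cuspSection Dα hDc hDcY s hsec hsD N hcusp
  map_GtpZN_eq_of_contSplitting Dα Dβ γ hΔ N c hY hYN haugN haugJN hopen
    ⟨_, hcont, hsplit, hzα _ hcont hsplit⟩ hzβ

end TwoSettings

end Thm16Sub

end Literature.AnabelianGeometry.EtaleTheta

end
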